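import Summits.KontsevichZagierPeriods.KontsevichZagierPeriods.Cruxes.HoffmanRelationInKZ.SketchDilationHomotopy

/-!
# drefute evidence — `PeakTransposition` (sketch stub (a) of line dilation-homotopy-transposition) CLOSES
by ONE `KZ.permRel` instance (the transposition `x₁ ↔ λ`), no null-set bookkeeping needed:
the two peak domains are images of each other under the swap and the common kernel depends on
`(λ, x₁)` only through `λ·x₁`.  Positive lemma: travels as item evidence for the lead (refuter seat).
-/

noncomputable section
set_option linter.dupNamespace false
open Set MeasureTheory
open Literature.NumberTheory.Transcendental

namespace Summit.KontsevichZagierPeriods.KontsevichZagierPeriods.Cruxes.HoffmanRelationInKZ.DilationHomotopy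

theorem peakTransposition_holds : PeakTransposition := by
  intro n K R R' hR hRi hR' hR'i
  set p : Equiv.Perm (Fin (n + 3)) := Equiv.swap (1 : Fin (n + 3)) (Fin.last (n + 2)) with hp
  have h10 : (0 : Fin (n + 3)) ≠ 1 := by simp
  have hl0 : (0 : Fin (n + 3)) ≠ Fin.last (n + 2) := by simp [Fin.ext_iff]
  have hp0 : p 0 = 0 := Equiv.swap_apply_of_ne_of_ne h10 hl0
  have hp1 : p 1 = Fin.last (n + 2) := Equiv.swap_apply_left _ _
  have hpl : p (Fin.last (n + 2)) = 1 := Equiv.swap_apply_right _ _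
  have hpm : ∀ i : Fin n, p i.succ.succ.castSucc = i.succ.succ.castSucc := by
    intro i
    apply Equiv.swap_apply_of_ne_of_ne
    · simp [Fin.ext_iff]
    · simp [Fin.ext_iff]; omega
  have hpp : ∀ x : Fin (n + 3) → ℝ, (x ∘ ⇑p) ∘ ⇑p = x := by
    intro x; ext i; simp [hp, Equiv.swap_apply_self]
  have key : ∀ x : Fin (n + 3) → ℝ, x ∈ R.domain → x ∘ ⇑p ∈ R'.domain := by
    intro x hx
    rw [hR] at hx; rw [hR']
    refine ⟨fun i => hx.1 (p i), ?_⟩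
    simpa [Function.comp, hp0, hpl] using hx.2
  have key' : ∀ w : Fin (n + 3) → ℝ, w ∈ R'.domain → w ∘ ⇑p ∈ R.domain := by
    intro w hw
    rw [hR'] at hw; rw [hR]
    refine ⟨fun i => hw.1 (p i), ?_⟩
    simpa [Function.comp, hp0, hp1] using hw.2
  refine KZ.permRel_subset_relations ⟨n + 3, R, R', p, ?_, ?_, rfl⟩
  · ext w
    simp only [mem_image]
    constructor
    · intro hw
      exact ⟨w ∘ ⇑p, key' w hw, hpp w⟩
    · rintro ⟨x, hx, rfl⟩
      exact key x hx
  · intro x hx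
    rw [hRi hx, hR'i (key x hx)]
    simp only [Function.comp, hp0, hp1, hpl, hpm, mul_comm]

end Summit.KontsevichZagierPeriods.KontsevichZagierPeriods.Cruxes.HoffmanRelationInKZ.DilationHomotopy
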